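import Summits.BirchSwinnertonDyer.Rank1Residual.GaloisImage.KolyvaginDerivativeClasses
import HarnessLib

/-!
# Descent of invariant classes when `H⁰(N, X) = 0`, and Kolyvagin's derivative classes
# `κ_r ∈ H¹(K, T/M)` ([Rubin00] Def. 4.4.4; THEOREM A3 of row T-DER)
# (cell `b2b-bsdres`, team n1011, seat p11 GEN 7, OWNERS row T-DER = skel/T-DER.md; file F4)

HONEST FRAMING (cell `b2b-bsdres`, run/shared/lean/b2b/bsd-rank1-residual/, verbatim in every
file): the goal of the cell is to DELETE the COMBINATION-SHAPED residual classes of the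
Birch–Swinnerton-Dyer formula for ALL analytic-rank `≤ 1` elliptic curves over `ℚ` — "full BSD
formula for every rank `≤ 1` curve in class `C`" assembled STRICTLY from published theorems — so
that the rank-`≤ 1` remainder becomes exactly the CONSTRUCTION-SHAPED classes, which are TYPED
(missing-input `Prop`s), NOT attempted. This is not "finishing BSD". Team n1011 (N10 / N11, the
additive block X4 ∧ `p = 3`): research route on the CONSTRUCTION-SHAPED class X4; no claim beyond the
stated classes; nothing is booked. TOOL theorems of continuous group cohomology (no definition, no
named fact, no `sorry`); curve-free and `p`-free.

## What

§1 (any topological group `G`, open normal subgroup `N`, topological representation `X` with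
`X^N = 0`): **every `G`-invariant class of `H¹(N, X)` is the restriction of a UNIQUE class of
`H¹(G, X)`** (`existsUnique_resSubgroup_eq_of_forall_conjMap_eq`) — the surjectivity half of the
inflation–restriction sequence `0 → H¹(G/N, X^N) → H¹(G, X) → H¹(N, X)^{G/N} → H²(G/N, X^N)` when
`X^N = 0`, proved directly on cocycles: for a cocycle `φ` on `N` with invariant class, the element
`m_g ∈ X` with `g·φ − φ = ∂ m_g` is unique, `g ↦ m_g` is a continuous crossed homomorphism of `G`
extending `φ`, and its class restricts to `[φ]` (Serre, *Galois Cohomology*, I §2.6 (b); the tree has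
the exactness at `H¹(G, X)` — `infOne_exact_resSubgroup` — but not this half).

§2 (THEOREM A3 of the row, [Rubin00] Def. 4.4.4 / [MR04] App. A (32)): for an Euler system `c`,
a coefficient map `red : T ⟶ T'` and the chosen generators of F3b at the bottom layer `i = ⊥`
(where `Gal(K̄/F_⊥) = Γ_K`), if `(T')^{Gal(K̄/K(r))} = 0` then there is a UNIQUE
`κ_r ∈ H¹(K, T') = H¹(Γ_K, T')` restricting to `D_r (red_* c_{⊥,r})`
(`existsUnique_res_eq_deriv`) — Kolyvagin's derivative class.  For `T' = E[3^{k+1}]` under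
`Irr(E[3])` the hypothesis `h0` is the tree's
`geomTorsion_eq_zero_of_commutator_fixed_of_irreducible` (`GaloisImage/AbelianExtensionTorsion`,
p252010) since every level contains `[Γ_K, Γ_K]` (rider R-A4; the `×3^k` lift for `k > 0` is one
lemma, not in this file).

References: K. Rubin, *Euler Systems* (2000), Def. 4.4.4, Lemma 4.4.2 (ii); J.-P. Serre, *Galois
Cohomology* (1997), I §2.6 (b); B. Mazur, K. Rubin, *Kolyvagin systems* (2004), App. A.
-/

noncomputable section

open CategoryTheory Function Finset Polynomial Field IsDedekindDomain Topology Filter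
open scoped NumberField Classical
open Literature.NumberTheory.GaloisRepresentations
open Literature.NumberTheory.EllipticCurves (subgroupConj subgroupConj_apply_coe)

universe u v w

namespace Summit.BirchSwinnertonDyer.Rank1Residual.GaloisImage

namespace Derivative

/-! ### §1 Descent of invariant classes when `X^N = 0` -/

section Descent

variable {R : Type u} [CommRing R] [TopologicalSpace R]
variable {G : Type v} [Group G] [TopologicalSpace G] [IsTopologicalGroup G]
variable (X : TopRep.{v} R G) (N : Subgroup G) [N.Normal]

omit [TopologicalSpace G] [IsTopologicalGroup G] [N.Normal] in
/-- If `X^N = 0`, an element of `X` is determined by its coboundary on `N`. [folklore] -/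
theorem eq_of_forall_rho_sub_eq (h0 : ∀ v : X, (∀ n : N, X.ρ (n : G) v = v) → v = 0) {a b : X}
    (h : ∀ n : N, X.ρ (n : G) a - a = X.ρ (n : G) b - b) : a = b := by
  rw [← sub_eq_zero]
  refine h0 (a - b) fun n => ?_
  rw [map_sub]
  exact sub_eq_sub_iff_sub_eq_sub.mp (h n)

/-- The value at `g` of the conjugate cocycle minus the cocycle: for the cocycle `φ` on `N` whose
class is fixed by `g`, there is `m ∈ X` with `g • φ(g⁻¹ n g) − φ(n) = n • m − m` for all `n ∈ N`.
[folklore] -/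
theorem exists_conj_sub_eq (g : G) (φ : contOneCocycles (subgroupRep X N))
    (hφ : conjMap X N g 1 (oneCocycleClass _ φ) = oneCocycleClass _ φ) :
    ∃ m : X, ∀ n : N, X.ρ g (φ.1 (subgroupConj N g n)) - φ.1 n = X.ρ (n : G) m - m := by
  rw [conjMap_oneCocycleClass, ← sub_eq_zero, ← oneCocycleClass_sub, oneCocycleClass_eq_zero_iff] at hφ
  obtain ⟨m, hm⟩ := hφ
  exact ⟨m, fun n => hm n⟩

/-- For `g = n₀ ∈ N` the element of `exists_conj_sub_eq` can be taken to be `φ(n₀)`: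
`n₀ • φ(n₀⁻¹ n n₀) − φ(n) = n • φ(n₀) − φ(n₀)`. [folklore] -/
theorem conj_sub_eq_of_mem (φ : contOneCocycles (subgroupRep X N)) (n₀ n : N) :
    X.ρ (n₀ : G) (φ.1 (subgroupConj N (n₀ : G) n)) - φ.1 n = X.ρ (n : G) (φ.1 n₀) - φ.1 n₀ := by
  have hconj : subgroupConj N (n₀ : G) n = n₀⁻¹ * (n * n₀) := Subtype.ext (by
    simp only [subgroupConj_apply_coe, Subgroup.coe_mul, Subgroup.coe_inv, mul_assoc])
  have e1 : φ.1 (n₀⁻¹ * (n * n₀)) =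
      φ.1 n₀⁻¹ + X.ρ ((n₀⁻¹ : N) : G) (φ.1 n + X.ρ (n : G) (φ.1 n₀)) := by
    rw [subgroup_cocycle_mul, subgroup_cocycle_mul]
  have e2 : φ.1 n₀⁻¹ = -(X.ρ ((n₀ : G)⁻¹) (φ.1 n₀)) := by
    rw [subgroup_cocycle_inv]
  rw [hconj, e1, e2]
  simp only [map_add, map_neg, Subgroup.coe_inv, ρ_apply_ρ_inv_apply]
  abel

/-- **Descent of `G`-invariant classes when `X^N = 0`** (the surjectivity-onto-invariants half of
inflation–restriction in degree one, Serre, *Galois Cohomology*, I §2.6 (b)): for an open normal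
subgroup `N` of a topological group `G` and a topological representation `X` of `G` with
`X^N = 0`, every class `y ∈ H¹(N, X)` fixed by the action of every `g ∈ G` is `res x` for a
UNIQUE `x ∈ H¹(G, X)`.  (Existence: the crossed homomorphism `g ↦ m_g`, `g·φ − φ = ∂ m_g`;
uniqueness: `res` is injective since its kernel is the inflation of `H¹(G/N, X^N) = 0` — here
proved directly from `X^N = 0` on cocycles.) [cite: SerreGaloisCohomology1997, I §2.6 (b)] -/
theorem existsUnique_resSubgroup_eq_of_forall_conjMap_eq (hN : IsOpen (N : Set G))
    (h0 : ∀ v : X, (∀ n : N, X.ρ (n : G) v = v) → v = 0)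
    (y : continuousCohomology 1 (subgroupRep X N)) (hy : ∀ g : G, conjMap X N g 1 y = y) :
    ∃! x : continuousCohomology 1 X, resSubgroup X N 1 x = y := by
  obtain ⟨φ, rfl⟩ := oneCocycleClass_surjective _ y
  -- the elements `m_g`
  have hex : ∀ g : G, ∃ m : X, ∀ n : N,
      X.ρ g (φ.1 (subgroupConj N g n)) - φ.1 n = X.ρ (n : G) m - m :=
    fun g => exists_conj_sub_eq X N g φ (hy g)
  choose m hm using hex
  have huniq : ∀ g (v : X), (∀ n : N, X.ρ g (φ.1 (subgroupConj N g n)) - φ.1 n = X.ρ (n : G) v - v) →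
      v = m g := fun g v hv => eq_of_forall_rho_sub_eq X N h0 fun n => by rw [← hv n, hm g n]
  -- `m` extends `φ`
  have hmN : ∀ n₀ : N, m n₀ = φ.1 n₀ := fun n₀ =>
    (huniq n₀ (φ.1 n₀) fun n => conj_sub_eq_of_mem X N φ n₀ n).symm
  -- `m` is a crossed homomorphism
  have hmul : ∀ g h : G, m (g * h) = m g + X.ρ g (m h) := by
    intro g h
    refine (huniq (g * h) _ fun n => ?_).symm
    -- `(gh)·φ (n) = g • (h·φ)(g⁻¹ n g)`
    have hconj : subgroupConj N (g * h) n = subgroupConj N h (subgroupConj N g n) :=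
      Subtype.ext (by simp only [subgroupConj_apply_coe, mul_inv_rev, mul_assoc])
    have hh := hm h (subgroupConj N g n)
    rw [sub_eq_iff_eq_add] at hh
    have hg := hm g n
    rw [sub_eq_iff_eq_add] at hg
    rw [hconj, ρ_mul_apply, hh, map_add, hg, map_sub, subgroupConj_apply_coe, ← ρ_mul_apply,
      show g * (g⁻¹ * ↑n * g) = ↑n * g by group, ρ_mul_apply]
    simp only [map_add]
    abel
  have hm1 : m 1 = 0 := by
    have h := hmul 1 1
    rw [mul_one, map_one] at h
    simpa using h
  -- continuity: on `N` the map is `φ`, and a crossed homomorphism continuous at `1` is continuous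
  have hcontN : ContinuousOn m (N : Set G) := by
    rw [continuousOn_iff_continuous_restrict]
    have : (N : Set G).restrict m = fun n : N => φ.1 n := funext fun n => hmN n
    rw [this]
    exact φ.1.continuous
  have hcont1 : ContinuousAt m 1 := hcontN.continuousAt (hN.mem_nhds N.one_mem)
  have hcont : Continuous m := by
    rw [continuous_iff_continuousAt]
    intro g₀
    have heq : m = fun x => m g₀ + X.ρ g₀ (m (g₀⁻¹ * x)) := funext fun x => by
      rw [← hmul, mul_inv_cancel_left]
    rw [heq]
    refine continuousAt_const.add ((X.ρ g₀).continuous.continuousAt.comp ?_)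
    have h1 : ContinuousAt m (g₀⁻¹ * g₀) := by rw [inv_mul_cancel]; exact hcont1
    exact h1.comp (continuous_const.mul continuous_id).continuousAt
  -- the global cocycle and its restriction
  let Φ : contOneCocycles X := ⟨⟨m, hcont⟩, fun g h => hmul g h⟩
  refine ⟨oneCocycleClass X Φ, ?_, ?_⟩
  · show resSubgroup X N 1 (oneCocycleClass X Φ) = oneCocycleClass _ φ
    rw [resSubgroup_oneCocycleClass]
    exact congrArg _ (Subtype.ext (ContinuousMap.ext fun n => hmN n))
  · -- uniqueness: `res` is injective when `X^N = 0`
    intro x hx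
    change resSubgroup X N 1 x = oneCocycleClass _ φ at hx
    obtain ⟨ψ, rfl⟩ := oneCocycleClass_surjective _ x
    rw [resSubgroup_oneCocycleClass, ← sub_eq_zero, ← oneCocycleClass_sub,
      oneCocycleClass_eq_zero_iff] at hx
    obtain ⟨v, hv⟩ := hx
    rw [← sub_eq_zero, ← oneCocycleClass_sub, oneCocycleClass_eq_zero_iff]
    refine ⟨v, fun g => ?_⟩
    set θ : contOneCocycles X := ψ - Φ with hθ
    -- `θ` restricted to `N` is the coboundary of `v`
    have hN' : ∀ n : N, θ.1 n = X.ρ (n : G) v - v := fun n => by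
      have h := hv n
      change ψ.1 (n : G) - φ.1 n = X.ρ (n : G) v - v at h
      change ψ.1 (n : G) - m n = _
      rw [hmN]
      exact h
    -- `w := θ g − (g v − v)` is fixed by `N`, hence zero
    have key : ∀ n : N, X.ρ (n : G) (θ.1 g - (X.ρ g v - v)) = θ.1 g - (X.ρ g v - v) := by
      intro n
      -- `θ (n g) = θ n + n θ g` and `θ (n g) = θ (g (g⁻¹ n g)) = θ g + g θ(g⁻¹ n g)`
      have h1 : θ.1 ((n : G) * g) = (X.ρ (n : G) v - v) + X.ρ (n : G) (θ.1 g) := by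
        rw [θ.2 n g, hN' n]
      have h2 : θ.1 ((n : G) * g) = θ.1 g + (X.ρ (n : G) (X.ρ g v) - X.ρ g v) := by
        rw [show ((n : G) * g) = g * ((subgroupConj N g n : N) : G) by
          rw [subgroupConj_apply_coe]; group]
        rw [θ.2 g _, hN' (subgroupConj N g n), subgroupConj_apply_coe, map_sub, ← ρ_mul_apply,
          show g * (g⁻¹ * ↑n * g) = ↑n * g by group, ρ_mul_apply]
      have h12 : X.ρ (n : G) (θ.1 g) =
          θ.1 g + (X.ρ (n : G) (X.ρ g v) - X.ρ g v) - (X.ρ (n : G) v - v) := by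
        rw [← h2, h1, add_sub_cancel_left]
      rw [map_sub, map_sub, h12]
      abel
    have hzero := h0 _ key
    rwa [sub_eq_zero] at hzero

end Descent

/-! ### §2 Kolyvagin's derivative classes `κ_r ∈ H¹(K, T')` (THEOREM A3) -/

section Kappa

variable {K : Type u} [Field K] [NumberField K] {ι : Type w} [Preorder ι] [OrderBot ι]
variable {A : Type v} [CommRing A] [TopologicalSpace A]
variable {M : Type u} [AddCommGroup M] [Module A M] [TopologicalSpace M] [IsTopologicalAddGroup M]
  [ContinuousSMul A M] [Module.Free A M] [Module.Finite A M]
variable {L : EulerSystemLevels K ι} {T : GaloisRep K A M} {p : ℕ} [Fact p.Prime] [Algebra ℤ_[p] A]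
variable {c : ∀ (i : ι) (r : L.Ideals), H1 T (L.level i r.1)}
variable {M' : Type u} [AddCommGroup M'] [Module A M'] [TopologicalSpace M'] [IsTopologicalAddGroup M']
  [ContinuousSMul A M'] {T' : GaloisRep K A M'}

/-- **THEOREM A3 — Kolyvagin's derivative class `κ_r`** ([Rubin00] Def. 4.4.4 + Lemma 4.4.2 (ii);
[MR04] App. A (32)).  At the bottom layer (`Gal(K̄/F_⊥) = Γ_K`), with the data and hypotheses of
F3b's `conjMap_deriv_eq` (an Euler system `c`, a coefficient map `red : T ⟶ T'`, chosen generators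
`σ_ℓ` of `Γ_K ⧸ Gal(K̄/K(ℓ))` lying in the other `Gal(K̄/K(q))`, arithmetic Frobenii `Fr_ℓ`, the
levels ramified at `ℓ`, `T'` killed by `N_ℓ` and `P_ℓ(1)`), and ASSUMING `(T')^{Gal(K̄/K(r))} = 0`
(`h0`; for `T' = E[3]`-type coefficients under `Irr` this is the tree's
`geomTorsion_eq_zero_of_commutator_fixed_of_irreducible`, p252010, as every level contains
`[Γ_K, Γ_K]`), there is a UNIQUE class `κ_r ∈ H¹(Γ_K, T')` whose restriction to `Gal(K̄/K(r))` is
the derivative `D_r (red_* c_{⊥,r})`. [cite: Rubin2000, Def. 4.4.4 and Lemma 4.4.2] -/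
theorem existsUnique_res_eq_deriv (hc : IsEulerSystem L T p c) (red : T.toTopRep ⟶ T'.toTopRep)
    (r : L.Ideals)
    (σ : HeightOneSpectrum (𝓞 K) → absoluteGaloisGroup K) (N : HeightOneSpectrum (𝓞 K) → ℕ)
    (Fr : HeightOneSpectrum (𝓞 K) → absoluteGaloisGroup K)
    (hσ : ∀ ℓ ∈ r.1, ∀ q ∈ r.1, q ≠ ℓ → σ ℓ ∈ L.tameLevel q)
    (hcov : ∀ ℓ ∈ r.1, ∀ g : absoluteGaloisGroup K, ∃ j < N ℓ, (σ ℓ ^ j)⁻¹ * g ∈ L.tameLevel ℓ)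
    (hinj : ∀ ℓ ∈ r.1, ∀ j₁ < N ℓ, ∀ j₂ < N ℓ, (σ ℓ ^ j₁)⁻¹ * σ ℓ ^ j₂ ∈ L.tameLevel ℓ → j₁ = j₂)
    (hFr : ∀ ℓ ∈ r.1, IsArithFrobAtPlace K ℓ (Fr ℓ))
    (hram : ∀ ℓ ∈ r.1, ∀ s ⊆ r.1, ℓ ∉ s → ¬ SubgroupIsUnramifiedAt K (L.level ⊥ (insert ℓ s)) ℓ)
    (hM₁ : ∀ ℓ ∈ r.1, ∀ v : M', (N ℓ : A) • v = 0)
    (hM₂ : ∀ ℓ ∈ r.1, ∀ v : M',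
      (rubinEulerFactor T.toRepresentation (cyclotomicCharacterToUnits K p A) (Fr ℓ)).eval 1 • v = 0)
    (comm)
    (h0 : ∀ v : T'.toTopRep, (∀ u : L.level ⊥ r.1, T'.toTopRep.ρ (u : absoluteGaloisGroup K) v = v) →
      v = 0) :
    ∃! κ : continuousCohomology 1 T'.toTopRep,
      resSubgroup T'.toTopRep (L.level ⊥ r.1) 1 κ =
        (r.1.noncommProd (fun ℓ => ∑ j ∈ range (N ℓ), (j : Module.End A (continuousCohomology 1
          (subgroupRep T'.toTopRep (L.level ⊥ r.1)))) *
          (conjMap T'.toTopRep (L.level ⊥ r.1) (σ ℓ) 1).hom.toLinearMap ^ j) comm)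
        (ContinuousCohomology.map (ContinuousMonoidHom.id _) (X := subgroupRep T.toTopRep (L.level ⊥ r.1))
          (Y := subgroupRep T'.toTopRep (L.level ⊥ r.1))
          ((TopRep.resFunctor (L.level ⊥ r.1).subtype).map red) 1 (c ⊥ r)) := by
  have htop : ∀ g : absoluteGaloisGroup K, g ∈ L.pLevel ⊥ := fun g => by
    rw [L.pLevel_bot]; exact Subgroup.mem_top g
  exact existsUnique_resSubgroup_eq_of_forall_conjMap_eq T'.toTopRep (L.level ⊥ r.1)
    (L.isOpen_level ⊥ r.1) h0 _ fun g =>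
      conjMap_deriv_eq hc red ⊥ r σ N Fr (fun ℓ _ => htop (σ ℓ)) hσ hcov hinj
        (fun ℓ _ => htop (Fr ℓ)) hFr hram hM₁ hM₂ comm g (htop g)

end Kappa

end Derivative

end Summit.BirchSwinnertonDyer.Rank1Residual.GaloisImage

end
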